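import Summits.QuantumFields.YangMills.Theorems.FluctuationComparisonRegPrIntLBackgroundFormCauchyShape
import HarnessLib

/-!
# THE CAUCHY SHAPE, GLOBAL EDITION: Lipschitz `B∕ρ` and C¹·¹ `16B∕ρ²` on a WHOLE window image with a uniform `2ρ`-collar — no smallness, no convexity
# (abstract, Mathlib-only up to ✓`…BackgroundFormCauchyShape`)

Cell `ym3-torus` (YM ladder rung R3 = continuum `SU(2)` Yang–Mills on the three-torus — a RUNG, NOT d = 4, NOT infinite volume, NOT a mass gap, NOT Clay).  Width seat
`ym-ust-20520-w5` (gen 20); `--supports stmt-QuantumFields-20520 --as helper`, count-neutral, definition-free, default heartbeats.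

WHAT.  ✓`…BackgroundFormCauchyShape` (this seat) read the Lipschitz ∕ C¹·¹ moduli of LINE g24-4's row BGFORM∘ off a bounded analytic extension LOCALLY: moves `< ρ`
(resp. `< ρ∕2`, corners within `ρ∕8`).  But the `hlip` ∕ `hC11` binders of LEAD w3-20520 g20's ✓`…BackgroundFormAlgebra.oneBond_le_of_sensitivity` ∕
`fourPoint_le_of_sensitivity` — and BGFORM∘'s clauses (lip) ∕ (C11) themselves — quantify over ALL pairs ∕ quadruples of the background window image `S′`, with no
smallness.  THIS FILE removes the smallness at NO cost in hypotheses beyond a uniform collar: if `𝒯` is complex-differentiable on `D`, `‖𝒯‖ ≤ B` on `D`, and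
`D ⊇ ball u (2ρ)` for EVERY `u ∈ S′` (a uniform `2ρ`-collar of the window image — print: the analyticity domain (1.11)–(1.14) p.262 is an `O(α₁)`-neighbourhood of
the real small-field configurations, uniformly), then
* ★★ `norm_sub_le_of_collar` — GLOBAL LIPSCHITZ on `S′`: `‖𝒯 u − 𝒯 u′‖ ≤ (B∕ρ)·‖u − u′‖` for all `u, u′ ∈ S′` (small moves: Schwarz on `ball u′ (2ρ)`; large moves
  `‖u − u′‖ ≥ 2ρ`: boundedness `2B ≤ (B∕ρ)·‖u − u′‖`);
* ★★★ `norm_c11_of_collar` — GLOBAL C¹·¹ on `S′`: for ALL `u₀₀ u₁₀ u₀₁ u₁₁ ∈ S′`,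
  `‖𝒯 u₁₁ − 𝒯 u₁₀ − 𝒯 u₀₁ + 𝒯 u₀₀‖ ≤ (16B∕ρ²)·‖u₁₀ − u₀₀‖·‖u₀₁ − u₀₀‖ + (2B∕ρ)·‖u₁₁ − u₁₀ − u₀₁ + u₀₀‖`, by a four-way case split on the two move sizes at `ρ∕2`:
  both small ⇒ the two-parameter Schwarz lemma at the parallelogram corner (which lies in the collar) + the Lipschitz defect; both large ⇒ boundedness
  (`4B ≤ (16B∕ρ²)·‖v₁‖‖v₂‖`); one large ⇒ two global Lipschitz legs along the small direction and `1 ≤ 2‖v_large‖∕ρ`;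
* ★★★ the DOCKING editions `lip_of_local_analytic_collar` ∕ `c11_of_local_analytic_collar` in the currency of ✓`…BackgroundFormAlgebra` (local term through the
  restriction to its support `S`, Σ-norm of the row, real parts): the `hlip` ∕ `hC11` binder TEXTS with `ℓ X := 2B∕ρ`, `h X := 16B∕ρ²`, for ALL window points — the
  only analytic input being «`𝒯_X` differentiable and bounded by `B_X` on a set containing the `2ρ`-collar (sup norm on `S → W`) of the restricted window image».
So an analytic edition BGFORMᵃ∘ of the row needs NO diameter condition on the background window: collar + bound give (lip) and (C11) outright.

HONEST SCOPE.  Case analysis over ✓`…BackgroundFormCauchyShape` (Schwarz ×2) and the triangle inequality; nothing of Bałaban's analyticity domains or bounds is asserted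
or proved; BGFORM∘ ∕ BGFORMᵃ∘ ∕ S2β ∕ GRAD∘ ∕ the five registered ∘-stubs ∕ `FluctuationComparisonRegPrIntL` (20520) NOT proved; no summit is proved by a helper; rung
R3 = SU(2) YM₃ on T³ — NOT d = 4, NOT infinite volume, NOT a mass gap, NOT Clay.  Sorry-free, axioms standard.

References: T. Bałaban, CMP **109** (1987) 249–301 [Balaban1987RG1] ((0.25) p.257; (1.11)–(1.14) p.262); CMP **102** (1985) 277–309 [Balaban1985Variational]
(Prop. 9 p.309, (182)–(190) pp.307–308).
-/

set_option autoImplicit false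

noncomputable section

namespace Summit.QuantumFields.YangMills.Theorems.FluctuationComparisonRegPrIntLBackgroundFormCauchyGlobal

open Set Metric
open Summit.QuantumFields.YangMills.Theorems.FluctuationComparisonRegPrIntLBackgroundFormCauchyShape

section Collar

variable {V : Type*} [NormedAddCommGroup V] [NormedSpace ℂ V] {𝒯 : V → ℂ} {D : Set V} {B : ℝ}

/-- ★★ **GLOBAL LIPSCHITZ ON A WINDOW IMAGE WITH A `2ρ`-COLLAR.**  `𝒯` complex-differentiable on `D`, `‖𝒯‖ ≤ B` on `D`, `ball u (2ρ) ⊆ D` for every `u ∈ S′`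
⟹ `‖𝒯 u − 𝒯 u′‖ ≤ (B∕ρ)·‖u − u′‖` for all `u, u′ ∈ S′` (no smallness: large moves are paid by boundedness). [cite: Balaban1987RG1, (0.25) p.257 and (1.11)-(1.14) p.262] -/
theorem norm_sub_le_of_collar (h𝒯 : DifferentiableOn ℂ 𝒯 D) (hB : ∀ p ∈ D, ‖𝒯 p‖ ≤ B) {ρ : ℝ} (hρ : 0 < ρ)
    {S' : Set V} (hcol : ∀ u ∈ S', ball u (2 * ρ) ⊆ D) {u u' : V} (hu : u ∈ S') (hu' : u' ∈ S') :
    ‖𝒯 u - 𝒯 u'‖ ≤ B / ρ * ‖u - u'‖ := by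
  have h2ρ : 0 < 2 * ρ := by linarith
  have huD : u ∈ D := hcol u hu (mem_ball_self h2ρ)
  have hu'D : u' ∈ D := hcol u' hu' (mem_ball_self h2ρ)
  have hB0 : 0 ≤ B := bound_nonneg_of_mem hB huD
  by_cases hsmall : ‖u - u'‖ < 2 * ρ
  · have key := norm_sub_le_of_ball_subset h𝒯 hB h2ρ (hcol u' hu') (u - u') hsmall
    rw [add_sub_cancel] at key
    refine key.trans (le_of_eq ?_)
    rw [mul_div_mul_left B ρ two_ne_zero]
  · rw [not_lt] at hsmall
    calc ‖𝒯 u - 𝒯 u'‖ ≤ ‖𝒯 u‖ + ‖𝒯 u'‖ := norm_sub_le _ _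
      _ ≤ B + B := add_le_add (hB u huD) (hB u' hu'D)
      _ = B / ρ * (2 * ρ) := by field_simp; ring
      _ ≤ B / ρ * ‖u - u'‖ := mul_le_mul_of_nonneg_left hsmall (by positivity)

/-- ★★★ **GLOBAL C¹·¹ ON A WINDOW IMAGE WITH A `2ρ`-COLLAR.**  Under the same hypotheses, for ALL `u₀₀ u₁₀ u₀₁ u₁₁ ∈ S′`:
`‖𝒯 u₁₁ − 𝒯 u₁₀ − 𝒯 u₀₁ + 𝒯 u₀₀‖ ≤ (16B∕ρ²)·(‖u₁₀ − u₀₀‖·‖u₀₁ − u₀₀‖) + (2B∕ρ)·‖u₁₁ − u₁₀ − u₀₁ + u₀₀‖`.  Four cases on the move sizes `‖u₁₀ − u₀₀‖`,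
`‖u₀₁ − u₀₀‖` at `ρ∕2`: both small — the two-parameter Schwarz lemma ✓`norm_mixedDiff_le_of_ball_subset` on `ball u₀₀ (2ρ)` at the parallelogram corner
`P = u₁₀ + u₀₁ − u₀₀` (which lies in `ball u₀₀ ρ`, so `ball P ρ ⊆ D`) plus the Lipschitz defect `𝒯 u₁₁ − 𝒯 P` (Schwarz for `‖u₁₁ − P‖ < ρ`, boundedness otherwise);
both large — `4B ≤ (16B∕ρ²)·‖v₁‖‖v₂‖`; one large — two Lipschitz legs (`norm_sub_le_of_collar`) in the small direction and `1 ≤ 2‖v_large‖∕ρ`.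
[cite: Balaban1987RG1, (0.25) p.257 and (1.11)-(1.14) p.262; Balaban1985Variational, Prop. 9 p.309 and (190) p.308] -/
theorem norm_c11_of_collar (h𝒯 : DifferentiableOn ℂ 𝒯 D) (hB : ∀ p ∈ D, ‖𝒯 p‖ ≤ B) {ρ : ℝ} (hρ : 0 < ρ)
    {S' : Set V} (hcol : ∀ u ∈ S', ball u (2 * ρ) ⊆ D) {u₀₀ u₁₀ u₀₁ u₁₁ : V}
    (h₀₀ : u₀₀ ∈ S') (h₁₀ : u₁₀ ∈ S') (h₀₁ : u₀₁ ∈ S') (h₁₁ : u₁₁ ∈ S') :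
    ‖𝒯 u₁₁ - 𝒯 u₁₀ - 𝒯 u₀₁ + 𝒯 u₀₀‖ ≤
      16 * B / ρ ^ 2 * (‖u₁₀ - u₀₀‖ * ‖u₀₁ - u₀₀‖) + 2 * B / ρ * ‖u₁₁ - u₁₀ - u₀₁ + u₀₀‖ := by
  have h2ρ : 0 < 2 * ρ := by linarith
  have mD : ∀ {u}, u ∈ S' → u ∈ D := fun hu => hcol _ hu (mem_ball_self h2ρ)
  have hB0 : 0 ≤ B := bound_nonneg_of_mem hB (mD h₀₀)
  set v₁ : V := u₁₀ - u₀₀ with hv₁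
  set v₂ : V := u₀₁ - u₀₀ with hv₂
  set w : V := u₁₁ - u₁₀ - u₀₁ + u₀₀ with hw
  have hcoef₁ : 0 ≤ 16 * B / ρ ^ 2 := by positivity
  have hcoef₂ : 0 ≤ 2 * B / ρ := by positivity
  have hrhs0 : 0 ≤ 16 * B / ρ ^ 2 * (‖v₁‖ * ‖v₂‖) + 2 * B / ρ * ‖w‖ := by positivity
  -- global Lipschitz between window points
  have lip : ∀ {u u'}, u ∈ S' → u' ∈ S' → ‖𝒯 u - 𝒯 u'‖ ≤ B / ρ * ‖u - u'‖ :=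
    fun hu hu' => norm_sub_le_of_collar h𝒯 hB hρ hcol hu hu'
  by_cases hs₁ : ‖v₁‖ < ρ / 2
  · by_cases hs₂ : ‖v₂‖ < ρ / 2
    · -- both small: Schwarz₂ at the parallelogram corner + Lipschitz defect
      set P : V := u₀₀ + v₁ + v₂ with hP
      have hball₀ : ball u₀₀ (2 * ρ) ⊆ D := hcol u₀₀ h₀₀
      have hmix := norm_mixedDiff_le_of_ball_subset h𝒯 hB h2ρ hball₀ v₁ v₂ (by linarith) (by linarith)
      have hc₁ : u₀₀ + v₁ = u₁₀ := by rw [hv₁]; abel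
      have hc₂ : u₀₀ + v₂ = u₀₁ := by rw [hv₂]; abel
      rw [← hP, hc₁, hc₂] at hmix
      -- `P` is within `ρ` of `u₀₀`, so `ball P ρ ⊆ D` and `P ∈ D`
      have hPu : ‖P - u₀₀‖ < ρ := by
        have hrw : P - u₀₀ = v₁ + v₂ := by rw [hP]; abel
        rw [hrw]
        calc ‖v₁ + v₂‖ ≤ ‖v₁‖ + ‖v₂‖ := norm_add_le _ _
          _ < ρ / 2 + ρ / 2 := add_lt_add hs₁ hs₂
          _ = ρ := by ring
      have hPball : ball P ρ ⊆ D := by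
        refine Subset.trans ?_ hball₀
        intro x hx
        rw [mem_ball, dist_eq_norm] at hx ⊢
        calc ‖x - u₀₀‖ = ‖(x - P) + (P - u₀₀)‖ := by congr 1; abel
          _ ≤ ‖x - P‖ + ‖P - u₀₀‖ := norm_add_le _ _
          _ < ρ + ρ := add_lt_add hx hPu
          _ = 2 * ρ := by ring
      have hPD : P ∈ D := hPball (mem_ball_self hρ)
      -- the Lipschitz defect from `P` to `u₁₁`, small or large
      have hwP : u₁₁ - P = w := by rw [hw, hP, hv₁, hv₂]; abel
      have hdef : ‖𝒯 u₁₁ - 𝒯 P‖ ≤ 2 * B / ρ * ‖w‖ := by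
        by_cases hws : ‖w‖ < ρ
        · have key := norm_sub_le_of_ball_subset h𝒯 hB hρ hPball w hws
          have hPw : P + w = u₁₁ := by rw [hw, hP, hv₁, hv₂]; abel
          rw [hPw] at key
          exact key
        · rw [not_lt] at hws
          calc ‖𝒯 u₁₁ - 𝒯 P‖ ≤ ‖𝒯 u₁₁‖ + ‖𝒯 P‖ := norm_sub_le _ _
            _ ≤ B + B := add_le_add (hB _ (mD h₁₁)) (hB _ hPD)
            _ = 2 * B / ρ * ρ := by rw [div_mul_cancel₀ _ hρ.ne']; ring
            _ ≤ 2 * B / ρ * ‖w‖ := mul_le_mul_of_nonneg_left hws hcoef₂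
      have hsplit : 𝒯 u₁₁ - 𝒯 u₁₀ - 𝒯 u₀₁ + 𝒯 u₀₀ = (𝒯 u₁₁ - 𝒯 P) + (𝒯 P - 𝒯 u₁₀ - 𝒯 u₀₁ + 𝒯 u₀₀) := by ring
      rw [hsplit]
      refine (norm_add_le _ _).trans ?_
      rw [add_comm]
      refine add_le_add (hmix.trans ?_) hdef
      -- `16B∕(2ρ)² ≤ 16B∕ρ²`
      have h16 : 16 * B / (2 * ρ) ^ 2 ≤ 16 * B / ρ ^ 2 :=
        div_le_div_of_nonneg_left (by positivity) (by positivity) (by nlinarith)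
      exact mul_le_mul_of_nonneg_right h16 (mul_nonneg (norm_nonneg _) (norm_nonneg _))
    · -- `v₁` small, `v₂` large: legs along `v₁`
      rw [not_lt] at hs₂
      have hleg₁ : ‖𝒯 u₁₀ - 𝒯 u₀₀‖ ≤ B / ρ * ‖v₁‖ := lip h₁₀ h₀₀
      have hleg₂ : ‖𝒯 u₁₁ - 𝒯 u₀₁‖ ≤ B / ρ * (‖v₁‖ + ‖w‖) := by
        refine (lip h₁₁ h₀₁).trans (mul_le_mul_of_nonneg_left ?_ (by positivity))
        have hrw : u₁₁ - u₀₁ = v₁ + w := by rw [hv₁, hw]; abel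
        rw [hrw]; exact norm_add_le _ _
      have hsplit : 𝒯 u₁₁ - 𝒯 u₁₀ - 𝒯 u₀₁ + 𝒯 u₀₀ = (𝒯 u₁₁ - 𝒯 u₀₁) - (𝒯 u₁₀ - 𝒯 u₀₀) := by ring
      rw [hsplit]
      refine (norm_sub_le _ _).trans ?_
      have hone : ‖v₁‖ ≤ ‖v₁‖ * (2 * ‖v₂‖ / ρ) := by
        have : 1 ≤ 2 * ‖v₂‖ / ρ := by rw [le_div_iff₀ hρ]; linarith
        nlinarith [norm_nonneg v₁]
      calc ‖𝒯 u₁₁ - 𝒯 u₀₁‖ + ‖𝒯 u₁₀ - 𝒯 u₀₀‖ ≤ B / ρ * (‖v₁‖ + ‖w‖) + B / ρ * ‖v₁‖ := add_le_add hleg₂ hleg₁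
        _ = 2 * (B / ρ) * ‖v₁‖ + B / ρ * ‖w‖ := by ring
        _ ≤ 2 * (B / ρ) * (‖v₁‖ * (2 * ‖v₂‖ / ρ)) + 2 * B / ρ * ‖w‖ := by
            refine add_le_add (mul_le_mul_of_nonneg_left hone (by positivity)) ?_
            have h2 : B / ρ ≤ 2 * B / ρ := div_le_div_of_nonneg_right (by nlinarith) hρ.le
            exact mul_le_mul_of_nonneg_right h2 (norm_nonneg _)
        _ = 4 * B / ρ ^ 2 * (‖v₁‖ * ‖v₂‖) + 2 * B / ρ * ‖w‖ := by field_simp; ring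
        _ ≤ 16 * B / ρ ^ 2 * (‖v₁‖ * ‖v₂‖) + 2 * B / ρ * ‖w‖ := by
            have h4 : 4 * B / ρ ^ 2 ≤ 16 * B / ρ ^ 2 := div_le_div_of_nonneg_right (by nlinarith) (by positivity)
            have := mul_le_mul_of_nonneg_right h4 (mul_nonneg (norm_nonneg v₁) (norm_nonneg v₂))
            linarith
  · rw [not_lt] at hs₁
    by_cases hs₂ : ‖v₂‖ < ρ / 2
    · -- `v₁` large, `v₂` small: legs along `v₂`
      have hleg₁ : ‖𝒯 u₀₁ - 𝒯 u₀₀‖ ≤ B / ρ * ‖v₂‖ := lip h₀₁ h₀₀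
      have hleg₂ : ‖𝒯 u₁₁ - 𝒯 u₁₀‖ ≤ B / ρ * (‖v₂‖ + ‖w‖) := by
        refine (lip h₁₁ h₁₀).trans (mul_le_mul_of_nonneg_left ?_ (by positivity))
        have hrw : u₁₁ - u₁₀ = v₂ + w := by rw [hv₂, hw]; abel
        rw [hrw]; exact norm_add_le _ _
      have hsplit : 𝒯 u₁₁ - 𝒯 u₁₀ - 𝒯 u₀₁ + 𝒯 u₀₀ = (𝒯 u₁₁ - 𝒯 u₁₀) - (𝒯 u₀₁ - 𝒯 u₀₀) := by ring
      rw [hsplit]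
      refine (norm_sub_le _ _).trans ?_
      have hone : ‖v₂‖ ≤ (2 * ‖v₁‖ / ρ) * ‖v₂‖ := by
        have : 1 ≤ 2 * ‖v₁‖ / ρ := by rw [le_div_iff₀ hρ]; linarith
        nlinarith [norm_nonneg v₂]
      calc ‖𝒯 u₁₁ - 𝒯 u₁₀‖ + ‖𝒯 u₀₁ - 𝒯 u₀₀‖ ≤ B / ρ * (‖v₂‖ + ‖w‖) + B / ρ * ‖v₂‖ := add_le_add hleg₂ hleg₁
        _ = 2 * (B / ρ) * ‖v₂‖ + B / ρ * ‖w‖ := by ring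
        _ ≤ 2 * (B / ρ) * ((2 * ‖v₁‖ / ρ) * ‖v₂‖) + 2 * B / ρ * ‖w‖ := by
            refine add_le_add (mul_le_mul_of_nonneg_left hone (by positivity)) ?_
            have h2 : B / ρ ≤ 2 * B / ρ := div_le_div_of_nonneg_right (by nlinarith) hρ.le
            exact mul_le_mul_of_nonneg_right h2 (norm_nonneg _)
        _ = 4 * B / ρ ^ 2 * (‖v₁‖ * ‖v₂‖) + 2 * B / ρ * ‖w‖ := by field_simp; ring
        _ ≤ 16 * B / ρ ^ 2 * (‖v₁‖ * ‖v₂‖) + 2 * B / ρ * ‖w‖ := by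
            have h4 : 4 * B / ρ ^ 2 ≤ 16 * B / ρ ^ 2 := div_le_div_of_nonneg_right (by nlinarith) (by positivity)
            have := mul_le_mul_of_nonneg_right h4 (mul_nonneg (norm_nonneg v₁) (norm_nonneg v₂))
            linarith
    · -- both large: boundedness
      rw [not_lt] at hs₂
      have hbig : ρ ^ 2 / 4 ≤ ‖v₁‖ * ‖v₂‖ := by
        have := mul_le_mul hs₁ hs₂ (by positivity) (norm_nonneg _)
        calc ρ ^ 2 / 4 = (ρ / 2) * (ρ / 2) := by ring
          _ ≤ ‖v₁‖ * ‖v₂‖ := this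
      calc ‖𝒯 u₁₁ - 𝒯 u₁₀ - 𝒯 u₀₁ + 𝒯 u₀₀‖
          ≤ ‖𝒯 u₁₁ - 𝒯 u₁₀ - 𝒯 u₀₁‖ + ‖𝒯 u₀₀‖ := norm_add_le _ _
        _ ≤ ‖𝒯 u₁₁ - 𝒯 u₁₀‖ + ‖𝒯 u₀₁‖ + ‖𝒯 u₀₀‖ := by linarith [norm_sub_le (𝒯 u₁₁ - 𝒯 u₁₀) (𝒯 u₀₁)]
        _ ≤ ‖𝒯 u₁₁‖ + ‖𝒯 u₁₀‖ + ‖𝒯 u₀₁‖ + ‖𝒯 u₀₀‖ := by linarith [norm_sub_le (𝒯 u₁₁) (𝒯 u₁₀)]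
        _ ≤ B + B + B + B := by linarith [hB _ (mD h₁₁), hB _ (mD h₁₀), hB _ (mD h₀₁), hB _ (mD h₀₀)]
        _ = 16 * B / ρ ^ 2 * (ρ ^ 2 / 4) := by field_simp; ring
        _ ≤ 16 * B / ρ ^ 2 * (‖v₁‖ * ‖v₂‖) := mul_le_mul_of_nonneg_left hbig hcoef₁
        _ ≤ 16 * B / ρ ^ 2 * (‖v₁‖ * ‖v₂‖) + 2 * B / ρ * ‖w‖ := le_add_of_nonneg_right (by positivity)

end Collar

/-! ## Docking editions (currency of ✓`…BackgroundFormAlgebra`): local terms through the restriction to their support, Σ-norm, real parts — for ALL window points -/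

section Docking

variable {E W : Type*} [NormedAddCommGroup W] [NormedSpace ℂ W]

/-- ★★★ **THE `hlip` SHAPE, GLOBAL.**  A local term through the restriction to its support `S` by `𝒯 : (S → W) → ℂ`, complex-differentiable and bounded by `B`
on a set `D` containing the `2ρ`-collar (sup norm) of the restricted window image `{u|_S : u ∈ S′}`: for ALL `u, u′ ∈ S′`,
`|Re 𝒯(u|_S) − Re 𝒯(u′|_S)| ≤ (2B∕ρ) · Σ_{e∈S} ‖u e − u′ e‖` — the `hlip` binder of ✓`oneBond_le_of_sensitivity` with `ℓ X := 2B∕ρ`, no move-size condition.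
[cite: Balaban1987RG1, (0.25) p.257 and (1.11)-(1.14) p.262] -/
theorem lip_of_local_analytic_collar (S : Finset E) {𝒯 : (↥S → W) → ℂ} {D : Set (↥S → W)} {B ρ : ℝ}
    (h𝒯 : DifferentiableOn ℂ 𝒯 D) (hB : ∀ p ∈ D, ‖𝒯 p‖ ≤ B) (hρ : 0 < ρ)
    (S' : Set (E → W)) (hcol : ∀ u ∈ S', ball (fun e : ↥S => u e) (2 * ρ) ⊆ D)
    (u u' : E → W) (hu : u ∈ S') (hu' : u' ∈ S') :
    |(𝒯 (fun e : ↥S => u e)).re - (𝒯 (fun e : ↥S => u' e)).re| ≤ 2 * B / ρ * ∑ e ∈ S, ‖u e - u' e‖ := by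
  have h2ρ : 0 < 2 * ρ := by linarith
  have hB0 : 0 ≤ B := bound_nonneg_of_mem hB (hcol u hu (mem_ball_self h2ρ))
  set R : Set (↥S → W) := (fun u : E → W => fun e : ↥S => u e) '' S' with hR
  have hcolR : ∀ r ∈ R, ball r (2 * ρ) ⊆ D := by
    rintro r ⟨x, hx, rfl⟩; exact hcol x hx
  have key := norm_sub_le_of_collar h𝒯 hB hρ hcolR (u := fun e : ↥S => u e) (u' := fun e : ↥S => u' e) ⟨u, hu, rfl⟩ ⟨u', hu', rfl⟩
  have hvn : ‖(fun e : ↥S => u e) - (fun e : ↥S => u' e)‖ ≤ ∑ e ∈ S, ‖u e - u' e‖ :=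
    pi_norm_restrict_le_sum S (fun e => u e - u' e)
  calc |(𝒯 (fun e : ↥S => u e)).re - (𝒯 (fun e : ↥S => u' e)).re|
      = |(𝒯 (fun e : ↥S => u e) - 𝒯 (fun e : ↥S => u' e)).re| := by rw [Complex.sub_re]
    _ ≤ ‖𝒯 (fun e : ↥S => u e) - 𝒯 (fun e : ↥S => u' e)‖ := Complex.abs_re_le_norm _
    _ ≤ B / ρ * ‖(fun e : ↥S => u e) - (fun e : ↥S => u' e)‖ := key
    _ ≤ B / ρ * ∑ e ∈ S, ‖u e - u' e‖ := mul_le_mul_of_nonneg_left hvn (by positivity)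
    _ ≤ 2 * B / ρ * ∑ e ∈ S, ‖u e - u' e‖ :=
        mul_le_mul_of_nonneg_right (div_le_div_of_nonneg_right (by nlinarith) hρ.le) (Finset.sum_nonneg fun e _ => norm_nonneg _)

/-- ★★★ **THE `hC11` SHAPE, GLOBAL.**  Same setting: for ALL `u₀₀ u₁₀ u₀₁ u₁₁ ∈ S′`,
`|Re 𝒯(u₁₁|_S) − Re 𝒯(u₁₀|_S) − Re 𝒯(u₀₁|_S) + Re 𝒯(u₀₀|_S)| ≤ (16B∕ρ²)·(Σ_{e∈S}‖u₁₀ e − u₀₀ e‖)·(Σ_{e∈S}‖u₀₁ e − u₀₀ e‖) + (2B∕ρ)·Σ_{e∈S}‖u₁₁ e − u₁₀ e − u₀₁ e + u₀₀ e‖`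
— LITERALLY the `hC11` binder of ✓`fourPoint_le_of_sensitivity` with `h X := 16B∕ρ²`, `ℓ X := 2B∕ρ` (same `ℓ X` as the `hlip` edition above), no move-size
condition. [cite: Balaban1987RG1, (0.25) p.257 and (1.11)-(1.14) p.262; Balaban1985Variational, Prop. 9 p.309 and (190) p.308] -/
theorem c11_of_local_analytic_collar (S : Finset E) {𝒯 : (↥S → W) → ℂ} {D : Set (↥S → W)} {B ρ : ℝ}
    (h𝒯 : DifferentiableOn ℂ 𝒯 D) (hB : ∀ p ∈ D, ‖𝒯 p‖ ≤ B) (hρ : 0 < ρ)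
    (S' : Set (E → W)) (hcol : ∀ u ∈ S', ball (fun e : ↥S => u e) (2 * ρ) ⊆ D)
    (u₀₀ u₁₀ u₀₁ u₁₁ : E → W) (h₀₀ : u₀₀ ∈ S') (h₁₀ : u₁₀ ∈ S') (h₀₁ : u₀₁ ∈ S') (h₁₁ : u₁₁ ∈ S') :
    |(𝒯 (fun e : ↥S => u₁₁ e)).re - (𝒯 (fun e : ↥S => u₁₀ e)).re - (𝒯 (fun e : ↥S => u₀₁ e)).re + (𝒯 (fun e : ↥S => u₀₀ e)).re| ≤
      16 * B / ρ ^ 2 * (∑ e ∈ S, ‖u₁₀ e - u₀₀ e‖) * (∑ e ∈ S, ‖u₀₁ e - u₀₀ e‖) +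
        2 * B / ρ * ∑ e ∈ S, ‖u₁₁ e - u₁₀ e - u₀₁ e + u₀₀ e‖ := by
  have h2ρ : 0 < 2 * ρ := by linarith
  have hB0 : 0 ≤ B := bound_nonneg_of_mem hB (hcol u₀₀ h₀₀ (mem_ball_self h2ρ))
  set R : Set (↥S → W) := (fun u : E → W => fun e : ↥S => u e) '' S' with hR
  have hcolR : ∀ r ∈ R, ball r (2 * ρ) ⊆ D := by
    rintro r ⟨x, hx, rfl⟩; exact hcol x hx
  set r₀₀ : ↥S → W := fun e => u₀₀ e with hr₀₀
  set r₁₀ : ↥S → W := fun e => u₁₀ e with hr₁₀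
  set r₀₁ : ↥S → W := fun e => u₀₁ e with hr₀₁
  set r₁₁ : ↥S → W := fun e => u₁₁ e with hr₁₁
  have key := norm_c11_of_collar h𝒯 hB hρ hcolR (u₀₀ := r₀₀) (u₁₀ := r₁₀) (u₀₁ := r₀₁) (u₁₁ := r₁₁)
    ⟨u₀₀, h₀₀, rfl⟩ ⟨u₁₀, h₁₀, rfl⟩ ⟨u₀₁, h₀₁, rfl⟩ ⟨u₁₁, h₁₁, rfl⟩
  have n₁₀ : ‖r₁₀ - r₀₀‖ ≤ ∑ e ∈ S, ‖u₁₀ e - u₀₀ e‖ := pi_norm_restrict_le_sum S (fun e => u₁₀ e - u₀₀ e)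
  have n₀₁ : ‖r₀₁ - r₀₀‖ ≤ ∑ e ∈ S, ‖u₀₁ e - u₀₀ e‖ := pi_norm_restrict_le_sum S (fun e => u₀₁ e - u₀₀ e)
  have n₂ : ‖r₁₁ - r₁₀ - r₀₁ + r₀₀‖ ≤ ∑ e ∈ S, ‖u₁₁ e - u₁₀ e - u₀₁ e + u₀₀ e‖ :=
    pi_norm_restrict_le_sum S (fun e => u₁₁ e - u₁₀ e - u₀₁ e + u₀₀ e)
  have hre : |(𝒯 r₁₁).re - (𝒯 r₁₀).re - (𝒯 r₀₁).re + (𝒯 r₀₀).re| ≤ ‖𝒯 r₁₁ - 𝒯 r₁₀ - 𝒯 r₀₁ + 𝒯 r₀₀‖ := abs_re_mixedDiff_le _ _ _ _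
  refine hre.trans (key.trans ?_)
  have hc₁ : 0 ≤ 16 * B / ρ ^ 2 := by positivity
  have hc₂ : 0 ≤ 2 * B / ρ := by positivity
  have hprod : ‖r₁₀ - r₀₀‖ * ‖r₀₁ - r₀₀‖ ≤ (∑ e ∈ S, ‖u₁₀ e - u₀₀ e‖) * (∑ e ∈ S, ‖u₀₁ e - u₀₀ e‖) :=
    mul_le_mul n₁₀ n₀₁ (norm_nonneg _) (Finset.sum_nonneg fun e _ => norm_nonneg _)
  calc 16 * B / ρ ^ 2 * (‖r₁₀ - r₀₀‖ * ‖r₀₁ - r₀₀‖) + 2 * B / ρ * ‖r₁₁ - r₁₀ - r₀₁ + r₀₀‖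
      ≤ 16 * B / ρ ^ 2 * ((∑ e ∈ S, ‖u₁₀ e - u₀₀ e‖) * (∑ e ∈ S, ‖u₀₁ e - u₀₀ e‖)) + 2 * B / ρ * ∑ e ∈ S, ‖u₁₁ e - u₁₀ e - u₀₁ e + u₀₀ e‖ :=
        add_le_add (mul_le_mul_of_nonneg_left hprod hc₁) (mul_le_mul_of_nonneg_left n₂ hc₂)
    _ = 16 * B / ρ ^ 2 * (∑ e ∈ S, ‖u₁₀ e - u₀₀ e‖) * (∑ e ∈ S, ‖u₀₁ e - u₀₀ e‖) +
        2 * B / ρ * ∑ e ∈ S, ‖u₁₁ e - u₁₀ e - u₀₁ e + u₀₀ e‖ := by ring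

end Docking

end Summit.QuantumFields.YangMills.Theorems.FluctuationComparisonRegPrIntLBackgroundFormCauchyGlobal
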